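import Summits.Schanuel.Schanuel.Theorems.ZilberEacFibreCurveCylinder
import HarnessLib

/-!
# Arbitrary base branches, XCVII: EVERY `y₁`-CYLINDER OF MANTOVA–MASSER'S CASE OVER A CURVE
# DEFINED OVER `ℚ̄` IS DENSE — the fibre relation exists automatically (dimension count)

HONEST FRAMING.  Cell `pub-schanuel` (Zilber's Exponential-Algebraic Closedness, case ladder;
host summit Schanuel), seat 2, gen 33.  File XCVI proved density for every surface `W` of the
case over an irreducible `F ∈ ℚ̄[x₀][x₁]` that is a cylinder in `y₁` AND satisfies some relation
`P(x₀, x₁; y₀) = 0` with `P ≢ 0 (mod F)`.  The relation is automatic: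
**`exists_fibrePolynomial_of_cylinder`** — if no such `P` existed, every `y₁`-coefficient of every
element of `I(W)` would be divisible by `F` (cylinder + `ℂ[x₀,x₁,y₀,y₁] = ℂ[x₀][x₁][y₀][y₁]`), so
`I(W) = (F)` and `dim W = dim ℂ[x₀,x₁,y₀,y₁]/(F) = 3` (the tree's
`ringKrullDim_quotient_span_of_prime_mvPolynomial`, Matsumura Thm 5.6), not `2`.  Hence
**`unprojectedDense_of_mmCase_cylinder`**: for every irreducible `F ∈ ℚ̄[x₀][x₁]` and EVERY surface
`W` of Mantova–Masser's case with base curve `{F = 0}` that is invariant under `y₁ ↦ t`, the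
unprojected exponential points are Zariski dense in `W`.  (O89 (a), the surfaces "fibred in
`y₀`-curves", is settled over curves defined over `ℚ̄`.)  What this is NOT: surfaces whose
equations involve `y₁`; transcendental coefficients (`{x₁ = x₀²/(2πi), y₀ = 1}` is a NON-dense
cylinder); Fib(3,2); EC(3,2) — OPEN; the question OPEN in general; NOT Schanuel's conjecture
(neither used nor implied); EAC ⇏ SC.
-/

noncomputable section

open Filter Topology Set Complex Polynomial
open Literature.NumberTheory.Transcendental Literature.ModelTheory.Zilber
open Literature.ModelTheory.ExponentialFields

set_option linter.dupNamespace false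

namespace Summit.Schanuel.Schanuel.Theorems

section FibreCurveCylinderAll

variable (F : ℂ[X][X])

/-- **A `y₁`-cylinder of the case satisfies a fibre relation `P(x₀, x₁; y₀) = 0` with
`P ≢ 0 (mod F)`** (dimension count; see the module docstring). [folklore] -/
theorem exists_fibrePolynomial_of_cylinder (hFirr : Irreducible F) {W : Set (Fin 2 ⊕ Fin 2 → ℂ)}
    (hmm : MMCaseDimPiOneFree W)
    (hbase : MvPolynomial.zeroLocus ℂ (MvPolynomial.vanishingIdeal ℂ (projAdd '' (W ∩ torusLocus ℂ 2))) =
      {x : Fin 2 → ℂ | (F.map (Polynomial.evalRingHom (x 0))).eval (x 1) = 0})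
    (hcyl : ∀ w ∈ W, ∀ t : ℂ, Function.update w (Sum.inr 1) t ∈ W) :
    ∃ P₀ : Polynomial ℂ[X][X], (∃ j, ¬ F ∣ P₀.coeff j) ∧
      ∀ w ∈ W, (P₀.map (Polynomial.eval₂RingHom (Polynomial.evalRingHom (w (Sum.inl 0)))
        (w (Sum.inl 1)))).eval (w (Sum.inr 0)) = 0 := by
  classical
  -- the embedding and the prime `𝔭 = I(W)` (as in file XCVI)
  set ι : Polynomial ℂ[X][X] →+* MvPolynomial (Fin 2 ⊕ Fin 2) ℂ := Polynomial.eval₂RingHom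
    (Polynomial.eval₂RingHom (Polynomial.eval₂RingHom MvPolynomial.C (MvPolynomial.X (Sum.inl 0)))
      (MvPolynomial.X (Sum.inl 1))) (MvPolynomial.X (Sum.inr 0)) with hι
  have hC : ∀ a : ℂ, ι (Polynomial.C (Polynomial.C (Polynomial.C a))) = MvPolynomial.C a := by
    intro a; simp only [hι, Polynomial.coe_eval₂RingHom, Polynomial.eval₂_C]
  have h0 : ι (Polynomial.C (Polynomial.C Polynomial.X)) = MvPolynomial.X (Sum.inl 0) := by
    simp only [hι, Polynomial.coe_eval₂RingHom, Polynomial.eval₂_C, Polynomial.eval₂_X]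
  have h1 : ι (Polynomial.C Polynomial.X) = MvPolynomial.X (Sum.inl 1) := by
    simp only [hι, Polynomial.coe_eval₂RingHom, Polynomial.eval₂_C, Polynomial.eval₂_X]
  have h2 : ι Polynomial.X = MvPolynomial.X (Sum.inr 0) := by
    simp only [hι, Polynomial.coe_eval₂RingHom, Polynomial.eval₂_X]
  have hev := eval_embed₃ ι hC h0 h1 h2
  set 𝔭 : Ideal (MvPolynomial (Fin 2 ⊕ Fin 2) ℂ) := MvPolynomial.vanishingIdeal ℂ W with h𝔭
  haveI h𝔭p : 𝔭.IsPrime := hmm.1.2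
  have hmem : ∀ G : Polynomial ℂ[X][X], ι G ∈ 𝔭 ↔ ∀ w ∈ W,
      (G.map (Polynomial.eval₂RingHom (Polynomial.evalRingHom (w (Sum.inl 0)))
        (w (Sum.inl 1)))).eval (w (Sum.inr 0)) = 0 := by
    intro G
    rw [h𝔭, MvPolynomial.mem_vanishingIdeal_iff]
    refine forall₂_congr fun w _ => ?_
    rw [MvPolynomial.aeval_eq_eval, hev]
  obtain ⟨w₀, hw₀W, hw₀T⟩ := hmm.2.1
  have hy : ∀ i : Fin 2, (MvPolynomial.X (Sum.inr i) : MvPolynomial (Fin 2 ⊕ Fin 2) ℂ) ∉ 𝔭 := by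
    intro i hi
    rw [h𝔭, MvPolynomial.mem_vanishingIdeal_iff] at hi
    have h := hi w₀ hw₀W
    rw [MvPolynomial.aeval_eq_eval, MvPolynomial.eval_X] at h
    exact (mem_torusLocus_iff.1 hw₀T) i h
  -- `F̃ = ι(F) ∈ 𝔭`
  have hFW : ∀ w ∈ W, w ∈ torusLocus ℂ 2 →
      (F.map (Polynomial.evalRingHom (w (Sum.inl 0)))).eval (w (Sum.inl 1)) = 0 := by
    intro w hwW hwT
    have hcl : projAdd w ∈ MvPolynomial.zeroLocus ℂ
        (MvPolynomial.vanishingIdeal ℂ (projAdd '' (W ∩ torusLocus ℂ 2))) :=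
      MvPolynomial.zeroLocus_vanishingIdeal_le _ ⟨w, ⟨hwW, hwT⟩, rfl⟩
    rw [hbase] at hcl
    exact hcl
  have hF : ι (Polynomial.C F) ∈ 𝔭 := by
    have hprod : ι (Polynomial.C F) * MvPolynomial.X (Sum.inr 0) * MvPolynomial.X (Sum.inr 1) ∈ 𝔭 := by
      rw [h𝔭, MvPolynomial.mem_vanishingIdeal_iff]
      intro w hwW
      rw [MvPolynomial.aeval_eq_eval, map_mul, map_mul, hev, MvPolynomial.eval_X, MvPolynomial.eval_X,
        Polynomial.map_C, Polynomial.eval_C, Polynomial.coe_eval₂RingHom, Polynomial.eval₂_eq_eval_map]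
      by_cases hwT : w ∈ torusLocus ℂ 2
      · rw [hFW w hwW hwT, zero_mul, zero_mul]
      · rw [mem_torusLocus_iff] at hwT
        push Not at hwT
        obtain ⟨i, hi⟩ := hwT
        fin_cases i
        · simp only [Fin.zero_eta] at hi; rw [hi, mul_zero, zero_mul]
        · simp only [Fin.mk_one] at hi; rw [hi, mul_zero]
    rcases h𝔭p.mem_or_mem hprod with h | h
    · exact (h𝔭p.mem_or_mem h).elim id fun h' => (hy 0 h').elim
    · exact (hy 1 h).elim
  -- suppose every `y₁`-free element of `𝔭` has all coefficients divisible by `F`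
  by_contra hnone
  push Not at hnone
  have hall : ∀ G : Polynomial ℂ[X][X], ι G ∈ 𝔭 → ∀ j, F ∣ G.coeff j := by
    intro G hG
    by_contra h
    push Not at h
    obtain ⟨w, hw, hne⟩ := hnone G h
    exact hne ((hmem G).1 hG w hw)
  -- then `𝔭 = (F̃)` (cylinder + `ℂ[x₀,x₁,y₀,y₁] = ℂ[x₀][x₁][y₀][y₁]`)
  have h𝔭eq : 𝔭 = Ideal.span {ι (Polynomial.C F)} := by
    refine le_antisymm ?_ ((Ideal.span_singleton_le_iff_mem _).2 hF)
    intro G hG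
    obtain ⟨Gy, hGy⟩ := exists_embed₃_poly ι hC h0 h1 h2 G
    have hcoef : ∀ m, ι (Gy.coeff m) ∈ 𝔭 := by
      intro m
      rw [h𝔭, MvPolynomial.mem_vanishingIdeal_iff]
      intro w hwW
      rw [MvPolynomial.aeval_eq_eval]
      have hsum : ∀ t : ℂ, ∑ m ∈ Finset.range (Gy.natDegree + 1),
          MvPolynomial.eval w (ι (Gy.coeff m)) * t ^ m = 0 := by
        intro t
        have hGt : MvPolynomial.eval (Function.update w (Sum.inr 1) t) G = 0 := by
          have h := (MvPolynomial.mem_vanishingIdeal_iff.1 hG) _ (hcyl w hwW t)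
          rwa [MvPolynomial.aeval_eq_eval] at h
        rw [← hGy, Polynomial.eval₂_eq_sum_range, map_sum] at hGt
        rw [← hGt]
        refine Finset.sum_congr rfl fun m _ => ?_
        rw [map_mul, map_pow, MvPolynomial.eval_X, Function.update_self, hev, hev]
        simp only [Function.update_of_ne (show (Sum.inl 0 : Fin 2 ⊕ Fin 2) ≠ Sum.inr 1 by decide),
          Function.update_of_ne (show (Sum.inl 1 : Fin 2 ⊕ Fin 2) ≠ Sum.inr 1 by decide),
          Function.update_of_ne (show (Sum.inr 0 : Fin 2 ⊕ Fin 2) ≠ Sum.inr 1 by decide)]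
      by_cases hm : m ≤ Gy.natDegree
      · exact coeff_eq_zero_of_forall_sum_eq_zero hsum m hm
      · rw [Polynomial.coeff_eq_zero_of_natDegree_lt (by omega), map_zero, map_zero]
    rw [Ideal.mem_span_singleton, ← hGy, Polynomial.eval₂_eq_sum_range]
    refine Finset.dvd_sum fun m _ => Dvd.dvd.mul_right ?_ _
    obtain ⟨H, hH⟩ := (Polynomial.C_dvd_iff_dvd_coeff F (Gy.coeff m)).2 (hall _ (hcoef m))
    exact ⟨ι H, by rw [hH, map_mul]⟩
  -- `F̃ ≠ 0` and `F̃` is prime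
  have hF0 : F ≠ 0 := hFirr.ne_zero
  have hFt0 : ι (Polynomial.C F) ≠ 0 := by
    intro h0
    apply hF0
    have hzero : ∀ x₀ x₁ : ℂ, (F.map (Polynomial.evalRingHom x₀)).eval x₁ = 0 := by
      intro x₀ x₁
      have h := hev (Sum.elim ![x₀, x₁] ![0, 0]) (Polynomial.C F)
      rw [h0, map_zero, Polynomial.map_C, Polynomial.eval_C, Polynomial.coe_eval₂RingHom,
        Polynomial.eval₂_eq_eval_map] at h
      simpa using h.symm
    refine Polynomial.ext fun j => Polynomial.funext fun x₀ => ?_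
    have hG : F.map (Polynomial.evalRingHom x₀) = 0 :=
      Polynomial.funext fun x₁ => by rw [hzero, Polynomial.eval_zero]
    have hj := congrArg (fun G : ℂ[X] => G.coeff j) hG
    simp only [Polynomial.coeff_map, Polynomial.coe_evalRingHom, Polynomial.coeff_zero] at hj
    rw [Polynomial.coeff_zero, Polynomial.eval_zero]
    exact hj
  have hprime : Prime (ι (Polynomial.C F)) :=
    (Ideal.span_singleton_prime hFt0).1 (h𝔭eq ▸ h𝔭p)
  -- dimension count: `dim W = dim ℂ[x₀,x₁,y₀,y₁]/(F̃) = 3 ≠ 2`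
  have h𝔭eq' : MvPolynomial.vanishingIdeal ℂ W = Ideal.span {ι (Polynomial.C F)} := by
    rw [← h𝔭]; exact h𝔭eq
  set f : MvPolynomial (Fin 2 ⊕ Fin 2) ℂ ≃+* MvPolynomial (Fin 4) ℂ :=
    (MvPolynomial.renameEquiv ℂ finSumFinEquiv).toRingEquiv with hf
  have hprime' : Prime (f (ι (Polynomial.C F))) := (MulEquiv.prime_iff f).2 hprime
  have hmap : Ideal.span {f (ι (Polynomial.C F))} =
      (Ideal.span {ι (Polynomial.C F)}).map (f : MvPolynomial (Fin 2 ⊕ Fin 2) ℂ →+* MvPolynomial (Fin 4) ℂ) := by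
    rw [Ideal.map_span, Set.image_singleton]
    rfl
  have hdim3 : zariskiDim ℂ W = ((4 - 1 : ℕ) : WithBot ℕ∞) := by
    rw [← Literature.RingTheory.KrullDimension.ringKrullDim_quotient_span_of_prime_mvPolynomial hprime']
    show ringKrullDim (MvPolynomial (Fin 2 ⊕ Fin 2) ℂ ⧸ MvPolynomial.vanishingIdeal ℂ W) = _
    exact (ringKrullDim_eq_of_ringEquiv (Ideal.quotEquivOfEq h𝔭eq')).trans
      (ringKrullDim_eq_of_ringEquiv (Ideal.quotientEquiv _ _ f hmap))
  have h23 : ((2 : ℕ) : WithBot ℕ∞) = ((4 - 1 : ℕ) : WithBot ℕ∞) := by rw [← hdim3]; exact hmm.2.2.1.symm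
  have := Nat.cast_injective (R := WithBot ℕ∞) h23
  omega

/-- **EVERY `y₁`-CYLINDER OF THE CASE OVER A CURVE DEFINED OVER `ℚ̄` IS DENSE.**  For every
irreducible `F ∈ ℚ̄[x₀][x₁]` and every surface `W` of Mantova–Masser's case with base curve
`{F = 0}` that is invariant under `y₁ ↦ t` (equivalently: defined by equations not involving
`y₁`; "fibred in `y₀`-curves"), the unprojected exponential points are Zariski dense in `W`.
[cite: MantovaMasser2023, §1 Further remarks, p. 5 (the question, open in general)] (new) -/
theorem unprojectedDense_of_mmCase_cylinder (hFirr : Irreducible F)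
    (halg : ∀ i j, IsAlgebraic ℚ ((F.coeff j).coeff i)) {W : Set (Fin 2 ⊕ Fin 2 → ℂ)}
    (hmm : MMCaseDimPiOneFree W)
    (hbase : MvPolynomial.zeroLocus ℂ (MvPolynomial.vanishingIdeal ℂ (projAdd '' (W ∩ torusLocus ℂ 2))) =
      {x : Fin 2 → ℂ | (F.map (Polynomial.evalRingHom (x 0))).eval (x 1) = 0})
    (hcyl : ∀ w ∈ W, ∀ t : ℂ, Function.update w (Sum.inr 1) t ∈ W) :
    UnprojectedDense W := by
  obtain ⟨P₀, hP₀nd, hP₀W⟩ := exists_fibrePolynomial_of_cylinder F hFirr hmm hbase hcyl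
  exact unprojectedDense_of_mmCase_cylinder_algebraic F hFirr halg hmm hbase hcyl P₀ hP₀nd hP₀W

/-- **The same, quantified as in the question** (`∀ W`). [cite: MantovaMasser2023, §1 Further
remarks, p. 5 (the question, open in general)] (new) -/
theorem unprojectedDensityQuestion_cylinder_algebraic (hFirr : Irreducible F)
    (halg : ∀ i j, IsAlgebraic ℚ ((F.coeff j).coeff i)) :
    ∀ W : Set (Fin 2 ⊕ Fin 2 → ℂ), MMCaseDimPiOneFree W →
      MvPolynomial.zeroLocus ℂ (MvPolynomial.vanishingIdeal ℂ (projAdd '' (W ∩ torusLocus ℂ 2))) =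
        {x : Fin 2 → ℂ | (F.map (Polynomial.evalRingHom (x 0))).eval (x 1) = 0} →
      (∀ w ∈ W, ∀ t : ℂ, Function.update w (Sum.inr 1) t ∈ W) → UnprojectedDense W :=
  fun _ hmm hbase hcyl => unprojectedDense_of_mmCase_cylinder F hFirr halg hmm hbase hcyl

/-- **Rational coefficients** (`F ∈ ℚ[x₀][x₁]` through a coefficient function).
[cite: MantovaMasser2023, §1 Further remarks, p. 5 (the question, open in general)] (new) -/
theorem unprojectedDense_of_mmCase_cylinder_ratCoeff (hFirr : Irreducible F)
    (c : ℕ → ℕ → ℚ) (hc : ∀ i j, (F.coeff j).coeff i = (c i j : ℂ)) {W : Set (Fin 2 ⊕ Fin 2 → ℂ)}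
    (hmm : MMCaseDimPiOneFree W)
    (hbase : MvPolynomial.zeroLocus ℂ (MvPolynomial.vanishingIdeal ℂ (projAdd '' (W ∩ torusLocus ℂ 2))) =
      {x : Fin 2 → ℂ | (F.map (Polynomial.evalRingHom (x 0))).eval (x 1) = 0})
    (hcyl : ∀ w ∈ W, ∀ t : ℂ, Function.update w (Sum.inr 1) t ∈ W) :
    UnprojectedDense W :=
  unprojectedDense_of_mmCase_cylinder F hFirr
    (fun i j => by rw [hc]; exact isAlgebraic_algebraMap (c i j)) hmm hbase hcyl

end FibreCurveCylinderAll

end Summit.Schanuel.Schanuel.Theorems
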